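import Literature.Geometry.Kaehler.ChainProjectionFormula
import Literature.Geometry.Kaehler.LelongLocalCover
import Literature.Geometry.Kaehler.LelongTheorem
import Literature.Geometry.Kaehler.AnalyticSetHausdorffNull
import Literature.Geometry.Kaehler.AnalyticSetComponentsLocFinProofs
import Literature.Geometry.Kaehler.HolomorphicChainLelongProofs
import HarnessLib

/-!
# The chain of an analytic set is a sheeted cover over the good base points of a proper projection

Let `A ⊆ Ω` be an analytic subset of pure dimension `p = q + 1` of an open subset `Ω` of a
finite-dimensional complex inner product space `V` (`dim V = (m + 1) + p`), `a ∈ A`, and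
`ι : ℂ^{m+1} → V` an injective linear map with `a` isolated in `A ∩ (a + im ι)` (an isolating
plane, [Chirka1989, §3.5]). In adapted coordinates `Θ : V ≃ K × ℂ^{m+1}` (`Θ ∘ ι = (0, ·)`,
`K` a complement of `im ι`, `dim K = p`) the local analytic cover of [Chirka1989, §3.7 Thm.]
(`CoverSetup`, `IsCoverDisc`, `CoverSetup.exists_sheets_nhds`,
`Literature/Analysis/Complex/AnalyticCover.lean`, `…/AnalyticSetComponentsProofs.lean`) makes
the chain `[A]` a **`k`-sheeted cover** (`HolomorphicChain.IsSheetedOver`,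
`ChainProjectionFormula.lean`) of the good base set `G = B(a₁, ε) ∖ {Δ = 0}` in the tube
`U = Θ⁻¹(B(a₁, ε) × B(a₂, r))` (inside any prescribed ball `B(a, ρ₀)`), along the base projection `ℓ = pr₁ ∘ Θ : V → K`
(`exists_isSheetedOver_ofSet`; the variant `exists_isSheetedOver_ofSet_disc` also returns the
discriminant `Δ` itself and the inclusion `A ∩ U ∩ ℓ⁻¹ G ⊆ reg A`), with:

* `k ≥ 1` (the sheet number — the multiplicity of the projection `ℓ|_A` at `a`,
  [Chirka1989, §11.1]); the sheet number is constant because the fibre cardinality is locally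
  constant on the preconnected `G` (`isPreconnected_ball_inter_preimage_compl`);
* `B(a₁, ε) ∖ G = {Δ = 0}` is `𝓗^{2p}`-null in `K`, and the part of `reg A ∩ U` over it is
  `𝓗^{2p}`-null in `V` (it is analytic of dimension `< p`,
  `finrank_lt_of_isRegPt_of_discriminant`, `IsAnalyticSet.euclideanHausdorffMeasure_image_eq_zero`);
* properness: `reg A ∩ U ∩ ℓ⁻¹ B̄(a₁, ρ')` lies in a compact subset of `U` for `ρ' < ε` (no
  points of `A` on the rim of the tube).

Together with `IsSheetedOver.lintegral_inter_preimage_eq_of_null` this is the projection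
formula `∫_{reg A ∩ U ∩ ℓ⁻¹ B(a₁,ρ')} ℓ^*Φ = k ∫_{B(a₁,ρ')} Φ` of the Monge–Ampère proof of
`n(A, a) = μ_a(A)` [Chirka1989, §15.1 Prop. 2].

## References

* E. M. Chirka, *Complex Analytic Sets*, Kluwer 1989, §3.5, §3.7 Thm., §11.1, §15.1 [Chirka1989].
-/

noncomputable section

open scoped Manifold Topology ENNReal NNReal InnerProductSpace
open Set Filter MeasureTheory Metric Module Function TopologicalSpace

universe u

namespace Literature.Geometry.Kaehler

open Literature.Geometry.GeometricMeasureTheory Literature.Analysis.Complex.SCV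
  Literature.Analysis.Complex.SCV.CoverSetup Literature.Geometry.Kaehler.SCV

variable {V : Type u} [NormedAddCommGroup V] [InnerProductSpace ℂ V] [FiniteDimensional ℂ V]
  [MeasurableSpace V] [BorelSpace V] {Ω : Opens V} {q : ℕ}

namespace HolomorphicChain

/-! ### Fibre cardinality of a cover over good base points -/

section Fibre

variable {E' : Type*} [NormedAddCommGroup E'] [NormedSpace ℂ E'] {m N : ℕ}
  {f : E' × (Fin (m + 1) → ℂ) → (Fin N → ℂ)} {a' : E'} {a'' : Fin (m + 1) → ℂ} {ε r : ℝ}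

omit [NormedSpace ℂ E'] in
/-- Over a base ball with sheets `σ j` (distinct values) describing `coverZero` exactly, the fibre
of `coverZero` over `z'` is `{σ j z'}` and has exactly `n` points. [folklore] -/
theorem ncard_fibre_eq_of_sheets {z₀ : E'} {δ : ℝ} {n : ℕ} {σ : Fin n → E' → (Fin (m + 1) → ℂ)}
    (hσne : ∀ z' ∈ ball z₀ δ, ∀ j j', j ≠ j' → σ j z' ≠ σ j' z')
    (hσiff : ∀ z' ∈ ball z₀ δ, ∀ w, (z', w) ∈ coverZero f a' a'' ε r ↔ ∃ j, w = σ j z')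
    {z' : E'} (hz' : z' ∈ ball z₀ δ) :
    {w | (z', w) ∈ coverZero f a' a'' ε r}.ncard = n := by
  classical
  have hset : {w | (z', w) ∈ coverZero f a' a'' ε r} = Set.range fun j => σ j z' := by
    ext w
    simp only [mem_setOf_eq, hσiff z' hz', mem_range, eq_comm]
  have hinj : Injective fun j => σ j z' := fun j j' h =>
    by_contra fun hne => hσne z' hz' j j' hne h
  rw [hset, Set.ncard_range_of_injective hinj, Nat.card_eq_fintype_card, Fintype.card_fin]

end Fibre

/-! ### The sheeted cover of `[A]` over the good base points -/

/-- **`[A]` is a `k`-sheeted cover over the good base points `{Δ ≠ 0}` of a proper projection** —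
the form of `exists_isSheetedOver_ofSet` which also returns the discriminant `Δ` (holomorphic on
the base ball, nowhere locally identically zero, `G = B(a₁, ε) ∖ {Δ = 0}`) and records that the
points of `A` in the tube over `G` are regular points (lie on the carrier `reg A` of `[A]`).
[cite: Chirka1989, §3.7 Thm., §11.1, §15.1] -/
theorem exists_isSheetedOver_ofSet_disc {A : Set Ω} (hA : HasPureDim 𝓘(ℂ, V) A (q + 1)) {a : V}
    (haA : a ∈ ((↑) : Ω → V) '' A) {m : ℕ} (hdim : finrank ℂ V = (m + 1) + (q + 1))
    (ι : (Fin (m + 1) → ℂ) →L[ℂ] V) (hι : Injective ι)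
    (hiso : ∀ᶠ w in 𝓝[≠] (0 : Fin (m + 1) → ℂ), a + ι w ∉ ((↑) : Ω → V) '' A) {ρ₀ : ℝ} (hρ₀ : 0 < ρ₀) :
    ∃ (K : Submodule ℂ V) (Θ : V ≃L[ℂ] (K × (Fin (m + 1) → ℂ))) (ε r : ℝ) (k : ℕ) (G : Set K)
      (U : Set V) (ℓ : V →L[ℂ] K),
      (∀ w, Θ (ι w) = (0, w)) ∧ 0 < ε ∧ 0 < r ∧ finrank ℂ K = q + 1 ∧ 1 ≤ k ∧
      (∀ x, ℓ x = (Θ x).1) ∧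
      U = {x | (Θ x).1 ∈ ball (Θ a).1 ε ∧ (Θ x).2 ∈ ball (Θ a).2 r} ∧ a ∈ U ∧ U ⊆ (Ω : Set V) ∩ ball a ρ₀ ∧
      G ⊆ ball (Θ a).1 ε ∧ (ofSet A hA).IsSheetedOver ℓ U G k ∧
      (μHE[2 * (q + 1)] : Measure K) (ball (Θ a).1 ε \ G) = 0 ∧
      (μHE[2 * (q + 1)] : Measure V) ((ofSet A hA).carrier ∩ U ∩ ℓ ⁻¹' (ball (Θ a).1 ε \ G)) = 0 ∧
      (∀ ρ', ρ' < ε → ∃ K' : Set V, IsCompact K' ∧ K' ⊆ U ∧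
        (ofSet A hA).carrier ∩ U ∩ ℓ ⁻¹' closedBall (Θ a).1 ρ' ⊆ K') ∧
      ∃ Δ : K → ℂ, DifferentiableOn ℂ Δ (ball (Θ a).1 ε) ∧ (∀ z' ∈ ball (Θ a).1 ε, ¬ Δ =ᶠ[𝓝 z'] 0) ∧
        G = {w | w ∈ ball (Θ a).1 ε ∧ Δ w ≠ 0} ∧
        ((↑) : Ω → V) '' A ∩ U ∩ ℓ ⁻¹' G ⊆ (ofSet A hA).carrier := by
  classical
  set T := ofSet A hA with hT
  set Aset : Set V := ((↑) : Ω → V) '' A with hAset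
  obtain ⟨a₀, ha₀A, rfl⟩ := haA
  have hAΩ : Aset ⊆ Ω := by rintro _ ⟨y, -, rfl⟩; exact y.2
  have hAzero : ∀ x ∈ (Ω : Set V), IsZeroSetAt Aset x := fun x hx => hA.isZeroSetAt_image_coe hx
  -- adapted coordinates
  obtain ⟨K, Θ, hΘι⟩ := exists_equiv_adapted ι hι
  set a₁ : K := (Θ a₀).1 with ha₁
  set a₂ : Fin (m + 1) → ℂ := (Θ a₀).2 with ha₂
  have hΘa : Θ a₀ = (a₁, a₂) := rfl
  have hKdim : finrank ℂ K = q + 1 := by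
    have h1 := Θ.toLinearEquiv.finrank_eq
    rw [finrank_prod, finrank_fin_fun] at h1
    omega
  -- equations of `Θ '' A` near `Θ a₀`, inside `Θ '' Ω`
  obtain ⟨U₀', hU₀'o, haU₀', N, f, hf', hZU₀'⟩ := (hAzero a₀ a₀.2).image_equiv Θ
  set U₀ : Set (K × (Fin (m + 1) → ℂ)) := U₀' ∩ Θ '' ((Ω : Set V) ∩ ball (a₀ : V) ρ₀) with hU₀
  have hU₀o : IsOpen U₀ := hU₀'o.inter (Θ.toHomeomorph.isOpenMap _ (Ω.isOpen.inter isOpen_ball))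
  have haU₀ : Θ a₀ ∈ U₀ := ⟨haU₀', mem_image_of_mem Θ ⟨a₀.2, mem_ball_self hρ₀⟩⟩
  have hf : DifferentiableOn ℂ f U₀ := hf'.mono inter_subset_left
  have hZU₀ : Θ '' Aset ∩ U₀ = U₀ ∩ f ⁻¹' {0} := by
    rw [hU₀, ← inter_assoc, hZU₀']
    ext x
    simp only [mem_inter_iff, mem_preimage]
    tauto
  have hU₀Ωb : ∀ x : V, Θ x ∈ U₀ → x ∈ (Ω : Set V) ∩ ball (a₀ : V) ρ₀ := by
    rintro x ⟨-, y, hy, hyx⟩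
    exact Θ.injective hyx ▸ hy
  have hU₀Ω : ∀ x : V, Θ x ∈ U₀ → x ∈ (Ω : Set V) := fun x hx => (hU₀Ωb x hx).1
  -- membership in `A` read through `f`
  have hAf : ∀ x : V, Θ x ∈ U₀ → (x ∈ Aset ↔ f (Θ x) = 0) := by
    intro x hxU₀
    constructor
    · intro hxA
      exact (hZU₀.subset ⟨mem_image_of_mem Θ hxA, hxU₀⟩).2
    · intro hfx
      obtain ⟨y, hyA, hy⟩ := (hZU₀.symm.subset ⟨hxU₀, hfx⟩).1
      exact Θ.injective hy ▸ hyA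
  -- isolation of `a₂` in the fibre over `a₁`
  have hisoT : ∀ᶠ w in 𝓝[≠] a₂, f (a₁, w) ≠ 0 := by
    have hpt : ∀ w, ((a₁, w) : K × (Fin (m + 1) → ℂ)) = Θ (a₀ + ι (w - a₂)) := by
      intro w
      rw [map_add, hΘι, hΘa, Prod.mk_add_mk, add_zero, add_sub_cancel]
    have ht : Tendsto (fun w : Fin (m + 1) → ℂ => w - a₂) (𝓝[≠] a₂) (𝓝[≠] 0) := by
      refine tendsto_nhdsWithin_of_tendsto_nhds_of_eventually_within _ ?_ ?_
      · have : Tendsto (fun w : Fin (m + 1) → ℂ => w - a₂) (𝓝 a₂) (𝓝 (a₂ - a₂)) :=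
          (continuous_id.sub continuous_const).continuousAt
        rw [sub_self] at this
        exact this.mono_left nhdsWithin_le_nhds
      · exact eventually_nhdsWithin_of_forall fun w hw h0 => hw (sub_eq_zero.1 h0)
    have hmemU₀ : ∀ᶠ w in 𝓝[≠] a₂, ((a₁, w) : K × (Fin (m + 1) → ℂ)) ∈ U₀ := by
      have hc : Continuous fun w : Fin (m + 1) → ℂ => ((a₁, w) : K × (Fin (m + 1) → ℂ)) := by
        fun_prop
      exact nhdsWithin_le_nhds (hc.continuousAt.preimage_mem_nhds (hU₀o.mem_nhds (hΘa ▸ haU₀)))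
    filter_upwards [ht.eventually hiso, hmemU₀] with w hw hwU₀ hf0
    apply hw
    have hmem : ((a₁, w) : K × (Fin (m + 1) → ℂ)) ∈ (Θ '' Aset) ∩ U₀ := by
      rw [hZU₀]; exact ⟨hwU₀, hf0⟩
    obtain ⟨z, hzA, hz⟩ := hmem.1
    rw [hpt w] at hz
    exact Θ.injective hz ▸ hzA
  -- the cover set-up and its discriminant
  obtain ⟨ε, r, C, F, rr, RR, hS, hsubU₀⟩ := exists_coverSetup hU₀o hf haU₀ hisoT
  obtain ⟨Δ, hΔ⟩ := hS.exists_isCoverDisc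
  have hΔd : DifferentiableOn ℂ Δ (ball a₁ ε) := hΔ.1
  have hΔne : ∀ z' ∈ ball a₁ ε, ¬ Δ =ᶠ[𝓝 z'] 0 := hΔ.2.1
  -- the tube, the base projection, the good base set
  set U : Set V := {x | (Θ x).1 ∈ ball a₁ ε ∧ (Θ x).2 ∈ ball a₂ r} with hU
  set ℓ : V →L[ℂ] K := (ContinuousLinearMap.fst ℂ K (Fin (m + 1) → ℂ)).comp
    (Θ : V →L[ℂ] K × (Fin (m + 1) → ℂ)) with hℓ
  have hℓapply : ∀ x, ℓ x = (Θ x).1 := fun x => rfl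
  set G : Set K := {w | w ∈ ball a₁ ε ∧ Δ w ≠ 0} with hG
  have hUo : IsOpen U := (isOpen_ball.prod isOpen_ball).preimage Θ.continuous
  have haU : (a₀ : V) ∈ U := ⟨mem_ball_self hS.ε_pos, mem_ball_self hS.r_pos⟩
  have hUU₀ : ∀ x ∈ U, Θ x ∈ U₀ := fun x hx => hsubU₀ ⟨hx.1, ball_subset_closedBall hx.2⟩
  have hUΩb : U ⊆ (Ω : Set V) ∩ ball (a₀ : V) ρ₀ := fun x hx => hU₀Ωb x (hUU₀ x hx)
  have hUΩ : U ⊆ (Ω : Set V) := fun x hx => (hUΩb hx).1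
  have hGo : IsOpen G := hΔd.continuousOn.isOpen_inter_preimage isOpen_ball isOpen_compl_singleton
  have hGball : G ⊆ ball a₁ ε := fun w hw => hw.1
  -- points of `A` in the tube are the points of `coverZero`
  have hcz : ∀ x : V, x ∈ Aset ∧ x ∈ U ↔ Θ x ∈ coverZero f a₁ a₂ ε r := by
    intro x
    rw [mem_coverZero_iff]
    constructor
    · rintro ⟨hxA, hxU⟩
      exact ⟨hxU, (hAf x (hUU₀ x hxU)).1 hxA⟩
    · rintro ⟨hxU, hfx⟩
      exact ⟨(hAf x (hUU₀ x hxU)).2 hfx, hxU⟩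
  have hcarA : T.carrier ⊆ Aset := by
    intro x hx
    have := (ofSet A hA).carrier_subset_image_support hx
    rwa [support_ofSet] at this
  -- regular points of the cover lie in the carrier
  have hregcar : ∀ x : V, Θ x ∈ coverZero f a₁ a₂ ε r → Δ (Θ x).1 ≠ 0 → x ∈ T.carrier := by
    intro x hx hΔx
    have hreg : IsRegPt (coverZero f a₁ a₂ ε r) (m + 1) (Θ x) := hS.isRegPt_of_mem_coverZero hΔ hx hΔx
    -- `coverZero` and `Θ '' Aset` agree on the open polydisc
    have hreg' : IsRegPt (Θ '' Aset) (m + 1) (Θ x) := by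
      refine hreg.congr isOpen_polydisc (mem_coverZero_iff.1 hx).1 ?_
      ext y
      constructor
      · rintro ⟨hy, hyP⟩
        obtain ⟨hyA, -⟩ := (hcz (Θ.symm y)).2 (by simpa using hy)
        exact ⟨⟨Θ.symm y, hyA, by simp⟩, hyP⟩
      · rintro ⟨⟨z, hzA, rfl⟩, hzP⟩
        exact ⟨(hcz z).1 ⟨hzA, hzP⟩, hzP⟩
    have hregA : IsRegPt Aset (m + 1) x := by
      have := hreg'.image_equiv Θ.symm
      simpa [Set.image_image] using this
    have hxA : x ∈ Aset := ((hcz x).2 hx).1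
    refine T.mem_carrier_of_isRegPt (q := m + 1) ?_ ?_
    · rw [hT, support_ofSet]; exact hxA
    · rw [hT, support_ofSet]; exact hregA
  -- the fibre cardinality is locally constant on `G`, hence constant
  set Nf : K → ℕ := fun w => {y | (w, y) ∈ coverZero f a₁ a₂ ε r}.ncard with hNf
  have hNfloc : ∀ w₀ ∈ G, ∀ᶠ w in 𝓝 w₀, Nf w = Nf w₀ := by
    intro w₀ hw₀
    obtain ⟨δ, hδ, -, n, σ, -, -, hσne, -, hσiff⟩ := hS.exists_sheets_nhds hΔ hw₀.1 hw₀.2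
    filter_upwards [ball_mem_nhds w₀ hδ] with w hw
    rw [hNf]
    simp only
    rw [ncard_fibre_eq_of_sheets hσne hσiff hw, ncard_fibre_eq_of_sheets hσne hσiff (mem_ball_self hδ)]
  have hNfc : ContinuousOn Nf G := fun w₀ hw₀ =>
    ((continuousAt_const (y := Nf w₀)).congr_of_eventuallyEq (hNfloc w₀ hw₀)).continuousWithinAt
  have hGpre : IsPreconnected G := by
    have hGeq : G = ball a₁ ε ∩ Δ ⁻¹' {0}ᶜ := by
      ext w; simp [hG]
    rw [hGeq]
    exact isPreconnected_ball_inter_preimage_compl hΔd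
  -- a good base point, and the sheet number `k`
  obtain ⟨g₀, hg₀⟩ : G.Nonempty := by
    have h1 : ∃ᶠ w in 𝓝 a₁, Δ w ≠ 0 := by
      have := hΔne a₁ (mem_ball_self hS.ε_pos)
      rwa [Filter.EventuallyEq, not_eventually] at this
    obtain ⟨w, hw, hwb⟩ := (h1.and_eventually (ball_mem_nhds a₁ hS.ε_pos)).exists
    exact ⟨w, hwb, hw⟩
  set k : ℕ := Nf g₀ with hk
  have hNfk : ∀ w ∈ G, Nf w = k := fun w hw => hGpre.constant hNfc hw hg₀
  -- the sheets over a good base ball, in `V`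
  have hsheets : ∀ w₀ ∈ G, ∃ W : Set K, IsOpen W ∧ w₀ ∈ W ∧ W ⊆ G ∧ ∃ s : Fin k → K → V,
      (∀ j, DifferentiableOn ℂ (s j) W) ∧ (∀ j, ∀ w ∈ W, ℓ (s j w) = w) ∧
      (∀ j, s j '' W ⊆ T.carrier ∩ U) ∧
      (∀ j, ∀ t ∈ W, ∃ N ∈ 𝓝 (s j t), T.carrier ∩ N ⊆ s j '' W) ∧
      (∀ i j, i ≠ j → ∀ w ∈ W, s i w ≠ s j w) ∧
      T.carrier ∩ U ∩ ℓ ⁻¹' W ⊆ ⋃ j, s j '' W := by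
    intro w₀ hw₀
    obtain ⟨δ, hδ, hδsub, n, σ, -, hσd, hσne, hσr, hσiff⟩ := hS.exists_sheets_nhds hΔ hw₀.1 hw₀.2
    have hnk : n = k := by
      rw [← hNfk w₀ hw₀, hNf]
      exact (ncard_fibre_eq_of_sheets hσne hσiff (mem_ball_self hδ)).symm
    subst hnk
    have hWG : ball w₀ δ ⊆ G := fun w hw => ⟨(hδsub hw).1, (hδsub hw).2⟩
    set s : Fin k → K → V := fun j w => Θ.symm (w, σ j w) with hs
    have hΘs : ∀ j w, Θ (s j w) = (w, σ j w) := fun j w => by simp [hs]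
    have hscz : ∀ j, ∀ w ∈ ball w₀ δ, Θ (s j w) ∈ coverZero f a₁ a₂ ε r := fun j w hw => by
      rw [hΘs]; exact (hσiff w hw _).2 ⟨j, rfl⟩
    have hsU : ∀ j, ∀ w ∈ ball w₀ δ, s j w ∈ U := fun j w hw => (mem_coverZero_iff.1 (hscz j w hw)).1
    have hscar : ∀ j, ∀ w ∈ ball w₀ δ, s j w ∈ T.carrier := fun j w hw =>
      hregcar _ (hscz j w hw) (by rw [hΘs]; exact (hδsub hw).2)
    -- a carrier point of the tube over the ball lies on a sheet
    have honsheet : ∀ z ∈ T.carrier ∩ U, (Θ z).1 ∈ ball w₀ δ → ∃ j, z = s j (Θ z).1 := by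
      rintro z ⟨hzc, hzU⟩ hz1
      have hz := (hcz z).1 ⟨hcarA hzc, hzU⟩
      obtain ⟨j, hj⟩ := (hσiff (Θ z).1 hz1 (Θ z).2).1 (by simpa using hz)
      refine ⟨j, Θ.injective ?_⟩
      rw [hΘs]
      exact Prod.ext rfl hj
    refine ⟨ball w₀ δ, isOpen_ball, mem_ball_self hδ, hWG, s, fun j => ?_, fun j w _ => ?_,
      fun j => ?_, fun j t ht => ?_, fun i j hij w hw h => ?_, ?_⟩
    · exact Θ.symm.differentiable.comp_differentiableOn (differentiableOn_id.prodMk (hσd j))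
    · rw [hℓapply, hΘs]
    · rintro _ ⟨w, hw, rfl⟩; exact ⟨hscar j w hw, hsU j w hw⟩
    · -- the neighbourhood excluding the other sheets
      set Nset : Set V := U ∩ Θ ⁻¹' ((ball w₀ δ ×ˢ univ) ∩
        ⋂ j' ∈ Finset.univ.erase j, {y | y.1 ∈ ball w₀ δ ∧ y.2 ≠ σ j' y.1}) with hNset
      have hNo : IsOpen Nset := by
        refine hUo.inter (IsOpen.preimage Θ.continuous ((isOpen_ball.prod isOpen_univ).inter
          (isOpen_biInter_finset fun j' _ => ?_)))
        have hc : ContinuousOn (fun y : K × (Fin (m + 1) → ℂ) => y.2 - σ j' y.1) (ball w₀ δ ×ˢ univ) :=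
          continuousOn_snd.sub ((hσd j').continuousOn.comp continuousOn_fst fun y hy => hy.1)
        have := hc.isOpen_inter_preimage (t := {(0 : Fin (m + 1) → ℂ)}ᶜ) (isOpen_ball.prod isOpen_univ)
          isOpen_compl_singleton
        convert this using 1
        ext y
        simp only [mem_setOf_eq, mem_inter_iff, mem_prod, mem_univ, and_true, mem_preimage, mem_compl_iff,
          mem_singleton_iff, sub_eq_zero]
      have htN : s j t ∈ Nset := by
        refine ⟨hsU j t ht, ?_⟩
        rw [mem_preimage, hΘs]
        refine ⟨⟨ht, trivial⟩, mem_iInter₂.2 fun j' hj' => ⟨ht, ?_⟩⟩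
        exact (hσne t ht j j' (Finset.ne_of_mem_erase hj').symm)
      refine ⟨Nset, hNo.mem_nhds htN, ?_⟩
      rintro z ⟨hzc, hzU, hzN⟩
      rw [mem_preimage] at hzN
      obtain ⟨⟨hz1, -⟩, hzother⟩ := hzN
      obtain ⟨i, hi⟩ := honsheet z ⟨hzc, hzU⟩ hz1
      have hij : i = j := by
        by_contra hne
        have := (mem_iInter₂.1 hzother i (Finset.mem_erase.2 ⟨hne, Finset.mem_univ i⟩)).2
        apply this
        conv_lhs => rw [hi, hΘs]
      subst hij
      exact ⟨(Θ z).1, hz1, hi.symm⟩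
    · apply hσne w hw i j hij
      have := congrArg (fun x => (Θ x).2) h
      simpa [hΘs] using this
    · rintro z ⟨hzcU, hzW⟩
      obtain ⟨j, hj⟩ := honsheet z hzcU hzW
      exact mem_iUnion.2 ⟨j, (Θ z).1, hzW, hj.symm⟩
  have hIS : T.IsSheetedOver ℓ U G k := ⟨hUo, hGo, hsheets⟩
  ----------------------------------------------------------------
  -- the base null set `{Δ = 0}`
  ----------------------------------------------------------------
  have hnullK : (μHE[2 * (q + 1)] : Measure K) (ball a₁ ε \ G) = 0 := by
    set ΩK : Opens K := ⟨ball a₁ ε, isOpen_ball⟩ with hΩK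
    set Z : Set ΩK := {w | Δ (w : K) = 0} with hZ
    have hZimg : ((↑) : ΩK → K) '' Z = ball a₁ ε \ G := by
      ext w
      constructor
      · rintro ⟨y, hy, rfl⟩
        exact ⟨y.2, fun hG' => hG'.2 hy⟩
      · rintro ⟨hw, hwG⟩
        refine ⟨⟨w, hw⟩, ?_, rfl⟩
        by_contra hΔw
        exact hwG ⟨hw, hΔw⟩
    have hZan : IsAnalyticSet 𝓘(ℂ, K) Z := by
      intro y
      refine isAnalyticSetAt_of_isZeroSetAt_chartImage (I := 𝓘(ℂ, K)) (x := y)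
        (by rw [Opens.extChartAt_source]; trivial) ?_
      rw [Opens.chartImage_eq, Opens.extChartAt_apply, hZimg]
      refine ⟨ball a₁ ε, isOpen_ball, y.2, 1, fun w _ => Δ w, differentiableOn_pi.2 fun _ => hΔd, ?_⟩
      ext w
      simp only [mem_inter_iff, mem_preimage, mem_singleton_iff]
      constructor
      · rintro ⟨⟨hw, hwG⟩, -⟩
        refine ⟨hw, funext fun _ => ?_⟩
        by_contra h
        exact hwG ⟨hw, h⟩
      · rintro ⟨hw, h0⟩
        have : Δ w = 0 := congrFun h0 0
        exact ⟨⟨hw, fun hG' => hG'.2 this⟩, hw⟩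
    have hcod : ∀ (y : ΩK) (c : ℕ), y ∈ Z → IsRegularPointOfCodim 𝓘(ℂ, K) Z c y →
        finrank ℂ K ≤ c + q := by
      intro y c hy hreg
      rcases Nat.eq_zero_or_pos c with rfl | hc
      · exfalso
        have h1 := hreg.isRegPt_chartImage (I := 𝓘(ℂ, K)) (x := y)
          (by rw [Opens.extChartAt_source]; trivial)
        rw [Opens.chartImage_eq, Opens.extChartAt_apply, hZimg] at h1
        obtain ⟨U', hU'o, hyU', g, -, hZU', -⟩ := h1
        apply hΔne (y : K) y.2
        filter_upwards [hU'o.mem_nhds hyU'] with w hw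
        have : w ∈ U' ∩ g ⁻¹' {0} := ⟨hw, Subsingleton.elim _ _⟩
        rw [← hZU'] at this
        have hw' := this.1.2
        simp only [hG, mem_setOf_eq, not_and, not_not] at hw'
        exact hw' this.1.1
      · rw [hKdim]; omega
    have := hZan.euclideanHausdorffMeasure_image_eq_zero hcod (Nat.lt_succ_self q)
    rwa [hZimg] at this
  ----------------------------------------------------------------
  -- the fibre bound and the null part of `A` over `{Δ = 0}`
  ----------------------------------------------------------------
  have hfib : ∀ z' ∈ ball (Θ a₀).1 ε, ∀ Fs : Finset V,
      (∀ x ∈ Fs, x ∈ Aset ∧ (Θ x).1 = z' ∧ (Θ x).2 ∈ closedBall (Θ a₀).2 r) →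
        Fs.card ≤ hS.boxBound := by
    intro z' hz' Fs hFs
    have hinj : Set.InjOn (fun x : V => (Θ x).2) (Fs : Set V) := by
      intro x hx x' hx' h
      have h1 : (Θ x).1 = (Θ x').1 := by rw [(hFs x hx).2.1, (hFs x' hx').2.1]
      exact Θ.injective (Prod.ext h1 h)
    have hmaps : ∀ x ∈ Fs, (Θ x).2 ∈ rootBox F a₂ rr z' := by
      intro x hx
      obtain ⟨hxA, hx1, hx2⟩ := hFs x hx
      have hmem : Θ x ∈ ball a₁ ε ×ˢ closedBall a₂ r := ⟨by rw [mem_ball, hx1]; exact hz', hx2⟩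
      have hfx : f (Θ x) = 0 := (hAf x (hsubU₀ hmem)).1 hxA
      have := hS.mem_rootBox_of_zero hmem hfx
      rwa [hx1] at this
    calc Fs.card = (Fs.image fun x : V => (Θ x).2).card := (Finset.card_image_of_injOn hinj).symm
      _ ≤ (rootBox F a₂ rr z').card := Finset.card_le_card (Finset.image_subset_iff.2 hmaps)
      _ ≤ hS.boxBound := hS.card_rootBox_le hz'
  set Bset : Set V := Aset ∩ (U ∩ {x | Δ (Θ x).1 = 0}) with hBset
  have hBnull : (μHE[2 * (q + 1)] : Measure V) Bset = 0 := by
    set ΩU : Opens V := ⟨U, hUo⟩ with hΩU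
    set Z : Set ΩU := {x | (x : V) ∈ Bset} with hZ
    have hZimg : ((↑) : ΩU → V) '' Z = Bset := by
      ext x
      constructor
      · rintro ⟨y, hy, rfl⟩; exact hy
      · intro hx; exact ⟨⟨x, hx.2.1⟩, hx, rfl⟩
    have hZan : IsAnalyticSet 𝓘(ℂ, V) Z := by
      intro y
      refine isAnalyticSetAt_of_isZeroSetAt_chartImage (I := 𝓘(ℂ, V)) (x := y)
        (by rw [Opens.extChartAt_source]; trivial) ?_
      rw [Opens.chartImage_eq, Opens.extChartAt_apply, hZimg, hBset]
      refine (hAzero y (hUΩ y.2)).inter ⟨U, hUo, y.2, 1, fun x _ => Δ (Θ x).1, ?_, ?_⟩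
      · refine differentiableOn_pi.2 fun _ => hΔd.comp ?_ fun x hx => hx.1
        exact ((ContinuousLinearMap.fst ℂ K (Fin (m + 1) → ℂ)).comp
          (Θ : V →L[ℂ] K × (Fin (m + 1) → ℂ))).differentiable.differentiableOn
      · ext x
        simp only [mem_inter_iff, mem_setOf_eq, mem_preimage, mem_singleton_iff, funext_iff,
          Pi.zero_apply, forall_const]
        tauto
    have hcod : ∀ (y : ΩU) (c : ℕ), y ∈ Z → IsRegularPointOfCodim 𝓘(ℂ, V) Z c y →
        finrank ℂ V ≤ c + q := by
      intro y c hy hreg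
      have h1 := hreg.isRegPt_chartImage (I := 𝓘(ℂ, V)) (x := y)
        (by rw [Opens.extChartAt_source]; trivial)
      rw [Opens.chartImage_eq, Opens.extChartAt_apply, hZimg] at h1
      have hlt := finrank_lt_of_isRegPt_of_discriminant (a := (a₀ : V)) (B := Bset) Θ hfib hΔne
        (fun x hx => hx.1) (fun x hx => ⟨hx.2.1.1, hx.2.1.2, hx.2.2⟩) hy h1
      rw [hKdim] at hlt
      omega
    have := hZan.euclideanHausdorffMeasure_image_eq_zero hcod (Nat.lt_succ_self q)
    rwa [hZimg] at this
  have hnullV : (μHE[2 * (q + 1)] : Measure V) (T.carrier ∩ U ∩ ℓ ⁻¹' (ball a₁ ε \ G)) = 0 := by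
    refine measure_mono_null ?_ hBnull
    rintro z ⟨⟨hzc, hzU⟩, hzℓ⟩
    rw [mem_preimage, hℓapply] at hzℓ
    refine ⟨hcarA hzc, hzU, ?_⟩
    have := hzℓ.2
    simp only [hG, mem_setOf_eq, not_and, not_not] at this
    exact this hzℓ.1
  ----------------------------------------------------------------
  -- `k ≥ 1`: the carrier has positive measure in the tube
  ----------------------------------------------------------------
  have hk1 : 1 ≤ k := by
    by_contra hk0
    have hk0' : k = 0 := by omega
    -- no carrier points over the good set
    have hempty : ∀ z ∈ T.carrier ∩ U, ℓ z ∉ G := by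
      intro z hz hzG
      obtain ⟨W, -, hzW, -, s, -, -, -, -, -, hcov⟩ := hsheets (ℓ z) hzG
      obtain ⟨j, -⟩ := mem_iUnion.1 (hcov ⟨hz, hzW⟩)
      exact (hk0' ▸ j).elim0
    have hsub : T.carrier ∩ U ⊆ T.carrier ∩ U ∩ ℓ ⁻¹' (ball a₁ ε \ G) := fun z hz =>
      ⟨hz, by rw [hℓapply]; exact hz.2.1, hempty z hz⟩
    have hnull0 : (μHE[2 * (q + 1)] : Measure V) (T.carrier ∩ U) = 0 := measure_mono_null hsub hnullV
    -- a regular point of `A` in the tube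
    have hdense := IsAnalyticSet.subset_closure_regularLocus_holds (I := 𝓘(ℂ, V)) (M := Ω)
      hA.isAnalyticSet ha₀A
    rw [_root_.mem_closure_iff] at hdense
    obtain ⟨y, hyU, hyreg⟩ := hdense {y : Ω | (y : V) ∈ U} (hUo.preimage continuous_subtype_val) haU
    have hycar : (y : V) ∈ T.carrier := by
      rw [hT, carrier_ofSet]; exact ⟨y, hyreg, rfl⟩
    -- positive measure near it
    obtain ⟨ρ₀, hρ₀, hballU⟩ := Metric.mem_nhds_iff.1 (hUo.mem_nhds hyU)
    have hratio := Chirka1989_lelongNumber_eq_one_of_mem_regularLocus V Ω (q + 1) A hA y hyreg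
    have hev := hratio.eventually (lt_mem_nhds (show (1 / 2 : ℝ≥0∞) < 1 by norm_num))
    obtain ⟨ρ, hρlt, hρ⟩ := (hev.and (Ioo_mem_nhdsGT hρ₀)).exists
    have hpos : (μHE[2 * (q + 1)] : Measure V) (Aset ∩ ball (y : V) ρ) ≠ 0 := by
      intro h0
      rw [← hAset, h0, ENNReal.zero_div] at hρlt
      exact absurd hρlt (by norm_num)
    apply hpos
    rw [hAset, measure_image_inter_eq_carrier_inter hA (ball (y : V) ρ), ← hT]
    exact measure_mono_null (show T.carrier ∩ ball (y : V) ρ ⊆ T.carrier ∩ U from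
      fun z hz => ⟨hz.1, hballU (ball_subset_ball hρ.2.le hz.2)⟩) hnull0
  ----------------------------------------------------------------
  -- properness: compact parts over compact base sets
  ----------------------------------------------------------------
  have hproper : ∀ ρ', ρ' < ε → ∃ K' : Set V, IsCompact K' ∧ K' ⊆ U ∧
      T.carrier ∩ U ∩ ℓ ⁻¹' closedBall a₁ ρ' ⊆ K' := by
    intro ρ' hρ'
    set C : Set V := Θ ⁻¹' (closedBall a₁ ρ' ×ˢ closedBall a₂ r) with hC
    have hCc : IsCompact C :=
      Θ.toHomeomorph.isCompact_preimage.2 ((isCompact_closedBall a₁ ρ').prod (isCompact_closedBall a₂ r))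
    have hCU₀ : ∀ x ∈ C, Θ x ∈ ball a₁ ε ×ˢ closedBall a₂ r := fun x hx =>
      ⟨closedBall_subset_ball hρ' hx.1, hx.2⟩
    have hCΩ : C ⊆ (Ω : Set V) := fun x hx => hU₀Ω x (hsubU₀ (hCU₀ x hx))
    refine ⟨Aset ∩ C, ?_, ?_, ?_⟩
    · -- compact: `A` is closed in `Ω` and `C ⊆ Ω` is compact
      set S : Set Ω := ((↑) : Ω → V) ⁻¹' C with hSdef
      have hSimg : ((↑) : Ω → V) '' S = C := by
        rw [hSdef, image_preimage_eq_inter_range, Subtype.range_coe, inter_eq_left.2 hCΩ]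
      have hSc : IsCompact S := by
        refine (Topology.IsInducing.subtypeVal.isCompact_iff).2 ?_
        convert hCc using 1
        exact hSimg
      have hASc : IsCompact (A ∩ S) := hSc.inter_left hA.isAnalyticSet.isClosed
      have himg : ((↑) : Ω → V) '' (A ∩ S) = Aset ∩ C := by
        rw [image_inter Subtype.val_injective, hSimg]
      rw [← himg]
      exact hASc.image continuous_subtype_val
    · rintro x ⟨hxA, hxC⟩
      have hmem := hCU₀ x hxC
      have hfx : f (Θ x) = 0 := (hAf x (hsubU₀ hmem)).1 hxA
      exact ⟨hmem.1, hS.mem_ball_of_mem_box fun i => (hS.zero _ hmem hfx i).1⟩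
    · rintro z ⟨⟨hzc, hzU⟩, hzℓ⟩
      rw [mem_preimage, hℓapply] at hzℓ
      exact ⟨hcarA hzc, hzℓ, ball_subset_closedBall hzU.2⟩
  have hAG : Aset ∩ U ∩ ℓ ⁻¹' G ⊆ T.carrier := fun x hx =>
    hregcar x ((hcz x).1 ⟨hx.1.1, hx.1.2⟩) (by
      have h := hx.2
      rw [mem_preimage, hℓapply] at h
      exact h.2)
  exact ⟨K, Θ, ε, r, k, G, U, ℓ, hΘι, hS.ε_pos, hS.r_pos, hKdim, hk1, hℓapply, rfl, haU, hUΩb, hGball,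
    hIS, hnullK, hnullV, hproper, Δ, hΔd, hΔne, rfl, hAG⟩

/-- **`[A]` is a `k`-sheeted cover over the good base points of a proper projection, with null
exceptional sets, `k ≥ 1`, and compact parts over compact base sets.** See the module docstring.
[cite: Chirka1989, §3.7 Thm., §11.1, §15.1] -/
theorem exists_isSheetedOver_ofSet {A : Set Ω} (hA : HasPureDim 𝓘(ℂ, V) A (q + 1)) {a : V}
    (haA : a ∈ ((↑) : Ω → V) '' A) {m : ℕ} (hdim : finrank ℂ V = (m + 1) + (q + 1))
    (ι : (Fin (m + 1) → ℂ) →L[ℂ] V) (hι : Injective ι)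
    (hiso : ∀ᶠ w in 𝓝[≠] (0 : Fin (m + 1) → ℂ), a + ι w ∉ ((↑) : Ω → V) '' A) {ρ₀ : ℝ} (hρ₀ : 0 < ρ₀) :
    ∃ (K : Submodule ℂ V) (Θ : V ≃L[ℂ] (K × (Fin (m + 1) → ℂ))) (ε r : ℝ) (k : ℕ) (G : Set K)
      (U : Set V) (ℓ : V →L[ℂ] K),
      (∀ w, Θ (ι w) = (0, w)) ∧ 0 < ε ∧ 0 < r ∧ finrank ℂ K = q + 1 ∧ 1 ≤ k ∧
      (∀ x, ℓ x = (Θ x).1) ∧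
      U = {x | (Θ x).1 ∈ ball (Θ a).1 ε ∧ (Θ x).2 ∈ ball (Θ a).2 r} ∧ a ∈ U ∧ U ⊆ (Ω : Set V) ∩ ball a ρ₀ ∧
      G ⊆ ball (Θ a).1 ε ∧ (ofSet A hA).IsSheetedOver ℓ U G k ∧
      (μHE[2 * (q + 1)] : Measure K) (ball (Θ a).1 ε \ G) = 0 ∧
      (μHE[2 * (q + 1)] : Measure V) ((ofSet A hA).carrier ∩ U ∩ ℓ ⁻¹' (ball (Θ a).1 ε \ G)) = 0 ∧
      (∀ ρ', ρ' < ε → ∃ K' : Set V, IsCompact K' ∧ K' ⊆ U ∧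
        (ofSet A hA).carrier ∩ U ∩ ℓ ⁻¹' closedBall (Θ a).1 ρ' ⊆ K') := by
  obtain ⟨K, Θ, ε, r, k, G, U, ℓ, h1, h2, h3, h4, h5, h6, h7, h8, h9, h10, h11, h12, h13, h14, -⟩ :=
    exists_isSheetedOver_ofSet_disc hA haA hdim ι hι hiso hρ₀
  exact ⟨K, Θ, ε, r, k, G, U, ℓ, h1, h2, h3, h4, h5, h6, h7, h8, h9, h10, h11, h12, h13, h14⟩

end HolomorphicChain

end Literature.Geometry.Kaehler

end
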